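import Literature.LinearAlgebra.Matrix.SymplecticNormalClosure
import HarnessLib

/-!
# `Sp_{2l}(K)` is generated by the unipotent radicals of the two opposite Siegel parabolics

Layer `Literature/LinearAlgebra/Matrix`, namespace `Literature.LinearAlgebra.Matrix.SymplecticMatrix`; lane
`lit-hodgefound` (Track 2 foundations), Layer A4, row **A4-39** stage (i) of
`run/shared/lean/pub/lit-hodgefound/SKELETON.md` (§A4-DETAIL). THEOREMS ONLY (no definition, no named fact).

For a FIELD `K` and a finite index type `l`, the matrix symplectic group `Sp_{2l}(K) = Matrix.symplecticGroup l K`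
is generated by the elements `n(b) = fromBlocks 1 b 0 1` and `v(c) = fromBlocks 1 0 c 1` (`b`, `c` symmetric) alone
— the Levi factor `m(a) = fromBlocks a 0 0 a⁻ᵀ` and the Weyl element `J` of the tree's generating set
(`SymplecticSiegelGeneration.lean`: `⟨m(GL_l), n(Sym_l), J⟩ = Sp_{2l}`) are themselves products of `n`'s and `v`'s:

* `J = n(-1) v(1) n(-1)` and `m(s) = n(-s) v(s⁻¹) n(-s) J⁻¹` for `s` symmetric invertible (the Weyl-element
  identity `unip_mul_low_mul_unip` of `SymplecticAbelianization.lean`), in particular for `s` diagonal;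
* **`low_mul_levi_transvection`**: for `i ≠ j` the Levi TRANSVECTION `m(1 + c E_{ij})` satisfies
  `v(c E_{jj}) m(1 + c E_{ij}) = n(c E_{ii}) v(E_{ij} + E_{ji}) n(-c E_{ii}) v(-(E_{ij} + E_{ji}))`
  (a commutator of root elements: block computation with `E_{ii}(E_{ij} + E_{ji}) = E_{ij}`,
  `(E_{ij} + E_{ji}) E_{ii} = E_{ji}`, `E_{ij} E_{ii} = 0`, `E_{ji} (E_{ij} + E_{ji}) = E_{jj}` for `i ≠ j`);
* invertible matrices are products of invertible diagonal matrices and transvections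
  (`Matrix.diagonal_transvection_induction_of_det_ne_zero`).

Hence **`eq_top_of_unip_low_mem`**: a subgroup of `Sp_{2l}(K)` containing every `n(b)` and every `v(c)` is the
whole group, and `closure_unip_low_eq_top`. This is the classical generation of `Sp_{2n}(K)` by elementary
symplectic matrices / symplectic transvections [O'Meara, *Symplectic Groups* (1978), §2.1–2.2; E. Artin,
*Geometric Algebra*, Chap. V (proof of Thm. 5.1, step 1: the normal subgroup generated by the transvections is
`Sp_n(k)`)], here in Siegel-parabolic form; it is the input of the ZARISKI DENSITY of `Sp_{2l}(ℤ)` in `Sp_{2l}(ℝ)`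
(row A4-39 stage (ii): the real points killed by all polynomials vanishing on `Sp_{2l}(ℤ)` form a subgroup
containing the one-parameter groups `n(tb)`, `v(tc)`).

## References

* [Artin1988] E. Artin, *Geometric Algebra* (1957/1988), Chap. V, Thm. 5.1 and its proof (held
  `book:artin1988-geometric-algebra`, chunks p0144–p0147).
* [Folland1989] G. B. Folland, *Harmonic Analysis in Phase Space*, §4.1 Prop. (4.10) (the generators `m`, `n`, `J`).
* [Margulis1991] G. A. Margulis, *Discrete Subgroups of Semisimple Lie Groups* (1991), Chap. I Prop. (3.2.11)
  (arithmetic subgroups are Zariski dense — the consumer, stage (ii)).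
-/

open Matrix
open Literature.RepresentationTheory.HeisenbergGroup.SymplecticMatrix

namespace Literature.LinearAlgebra.Matrix.SymplecticMatrix

variable {l : Type*} [DecidableEq l] [Fintype l] {K : Type*} [Field K]

/-! ## §1. `J` and the symmetric Levi elements are products of `n`'s and `v`'s -/

/-- **`J = n(-1) v(1) n(-1)`** — the Weyl element is a product of root unipotents (the Weyl-element identity at
`s = 1`). [cite: Folland1989, §4.1 Prop. (4.10)] -/
theorem symJ_eq_unip_mul_low_mul_unip :
    SymplecticGroup.symJ l K =
      unip (-(1 : Matrix l l K)) isSymm_one.neg * low (1 : Matrix l l K) isSymm_one *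
        unip (-(1 : Matrix l l K)) isSymm_one.neg := by
  have h := unip_mul_low_mul_unip (1 : GL l K) (by rw [Units.val_one]; exact isSymm_one)
  rw [levi_one, one_mul] at h
  exact h.symm

/-- A subgroup containing every `n(b)` and every `v(c)` contains `J`. [cite: Folland1989, §4.1 Prop. (4.10)] -/
theorem symJ_mem_of_unip_low_mem {H : Subgroup (Matrix.symplecticGroup l K)}
    (hn : ∀ (b : Matrix l l K) (hb : b.IsSymm), unip b hb ∈ H)
    (hv : ∀ (c : Matrix l l K) (hc : c.IsSymm), low c hc ∈ H) : SymplecticGroup.symJ l K ∈ H := by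
  rw [symJ_eq_unip_mul_low_mul_unip]
  exact H.mul_mem (H.mul_mem (hn _ _) (hv _ _)) (hn _ _)

/-- A subgroup containing every `n(b)` and every `v(c)` contains `m(s)` for every SYMMETRIC `s ∈ GL_l(K)`
(`m(s) = n(-s) v(s⁻¹) n(-s) J⁻¹`). [cite: Folland1989, §4.1 Prop. (4.10)] -/
theorem levi_mem_of_isSymm_of_unip_low_mem {H : Subgroup (Matrix.symplecticGroup l K)}
    (hn : ∀ (b : Matrix l l K) (hb : b.IsSymm), unip b hb ∈ H)
    (hv : ∀ (c : Matrix l l K) (hc : c.IsSymm), low c hc ∈ H) (s : GL l K) (hs : (s : Matrix l l K).IsSymm) :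
    levi s ∈ H := by
  have h := unip_mul_low_mul_unip s hs
  rw [(eq_mul_inv_iff_mul_eq.2 h.symm : levi s = _ * (SymplecticGroup.symJ l K)⁻¹)]
  exact H.mul_mem (H.mul_mem (H.mul_mem (hn _ _) (hv _ _)) (hn _ _)) (H.inv_mem (symJ_mem_of_unip_low_mem hn hv))

/-! ## §2. The Levi transvections as commutators of root unipotents -/

section Transvection

variable {i j : l}

/-- `E_{ii} (E_{ij} + E_{ji}) = E_{ij}` for `i ≠ j` (with a scalar `c` on `E_{ii}`). [folklore] -/
private theorem single_ii_mul (hij : i ≠ j) (c : K) :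
    Matrix.single i i c * (Matrix.single i j (1 : K) + Matrix.single j i 1) = Matrix.single i j c := by
  rw [Matrix.mul_add, single_mul_single_same, mul_one, single_mul_single_of_ne c i i j hij (1 : K), add_zero]

/-- `(E_{ij} + E_{ji}) E_{ii} = E_{ji}` for `i ≠ j`. [folklore] -/
private theorem mul_single_ii (hij : i ≠ j) (c : K) :
    (Matrix.single i j (1 : K) + Matrix.single j i 1) * Matrix.single i i c = Matrix.single j i c := by
  rw [Matrix.add_mul, single_mul_single_of_ne (1 : K) i j i hij.symm c, single_mul_single_same, one_mul, zero_add]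

/-- `E_{ij} E_{ii} = 0` for `i ≠ j`. [folklore] -/
private theorem single_ij_mul_single_ii (hij : i ≠ j) (c d : K) :
    Matrix.single i j c * Matrix.single i i d = 0 :=
  single_mul_single_of_ne c i j i hij.symm d

/-- `E_{ji} (E_{ij} + E_{ji}) = E_{jj}` for `i ≠ j` (with a scalar). [folklore] -/
private theorem single_ji_mul (hij : i ≠ j) (c : K) :
    Matrix.single j i c * (Matrix.single i j (1 : K) + Matrix.single j i 1) = Matrix.single j j c := by
  rw [Matrix.mul_add, single_mul_single_same, mul_one, single_mul_single_of_ne c j i j hij (1 : K), add_zero]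

/-- `E_{jj} E_{ij} = 0` for `i ≠ j`. [folklore] -/
private theorem single_jj_mul_single_ij (hij : i ≠ j) (c d : K) :
    Matrix.single j j c * Matrix.single i j d = 0 :=
  single_mul_single_of_ne c j j i hij.symm d

omit [Fintype l] in
/-- The symmetric matrix `c E_{kk}`. [folklore] -/
private theorem isSymm_single_same (k : l) (c : K) : (Matrix.single k k c).IsSymm := by
  change (Matrix.single k k c)ᵀ = _
  rw [transpose_single]

omit [Fintype l] in
/-- `E_{ij} + E_{ji}` is symmetric. [folklore] -/
private theorem isSymm_single_add_single (i j : l) :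
    (Matrix.single i j (1 : K) + Matrix.single j i 1).IsSymm := by
  change (Matrix.single i j (1 : K) + Matrix.single j i 1)ᵀ = _
  rw [transpose_add, transpose_single, transpose_single, add_comm]

/-- **The Levi transvection as a commutator of root unipotents**: for `i ≠ j` and `u ∈ GL_l(K)` with matrix
`1 + c E_{ij}`,
`v(c E_{jj}) · m(u) = n(c E_{ii}) · v(E_{ij} + E_{ji}) · n(-c E_{ii}) · v(-(E_{ij} + E_{ji}))`.
[cite: Artin1988, Chap. V Thm 5.1 (proof: the transvections generate)] -/
theorem low_mul_levi_transvection (hij : i ≠ j) (c : K) (u : GL l K) (hu : (u : Matrix l l K) = transvection i j c) :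
    (low (Matrix.single j j c) (isSymm_single_same j c) * levi u : Matrix.symplecticGroup l K) =
      unip (Matrix.single i i c) (isSymm_single_same i c) *
        low (Matrix.single i j (1 : K) + Matrix.single j i 1) (isSymm_single_add_single i j) *
        unip (-Matrix.single i i c) (isSymm_single_same i c).neg *
        low (-(Matrix.single i j (1 : K) + Matrix.single j i 1)) (isSymm_single_add_single i j).neg := by
  -- the inverse of `u` is the transvection with `-c`, whose transpose is `1 - c E_{ji}`
  have hui : ((u⁻¹ : GL l K) : Matrix l l K) = transvection i j (-c) := by
    rw [Matrix.coe_units_inv, hu]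
    refine Matrix.inv_eq_right_inv ?_
    rw [transvection_mul_transvection_same i j hij c (-c), add_neg_cancel, transvection_zero]
  have hT : (transvection i j (-c) : Matrix l l K)ᵀ = 1 - Matrix.single j i c := by
    rw [transvection, transpose_add, transpose_one, transpose_single, ← single_neg, sub_eq_add_neg]
  -- abbreviations and the elementary products
  set B : Matrix l l K := Matrix.single i i c with hB
  set C : Matrix l l K := Matrix.single i j (1 : K) + Matrix.single j i 1 with hC
  have hBC : B * C = Matrix.single i j c := single_ii_mul hij c
  have hCB : C * B = Matrix.single j i c := mul_single_ii hij c
  have hBCB : B * C * B = 0 := by rw [hBC, hB, single_ij_mul_single_ii hij]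
  have hCBC : C * B * C = Matrix.single j j c := by rw [hCB, hC, single_ji_mul hij]
  -- left-hand side
  have lhs : ((low (Matrix.single j j c) (isSymm_single_same j c) * levi u : Matrix.symplecticGroup l K) :
      Matrix (l ⊕ l) (l ⊕ l) K) =
      fromBlocks (1 + Matrix.single i j c) 0 (Matrix.single j j c) (1 - Matrix.single j i c) := by
    rw [Submonoid.coe_mul, coe_low, coe_levi, hui, hT, hu, transvection]
    simp only [fromBlocks_multiply, Matrix.one_mul, Matrix.mul_one, Matrix.zero_mul, Matrix.mul_zero, zero_add,
      add_zero, Matrix.mul_add, single_jj_mul_single_ij hij]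
  -- right-hand side, multiplied out step by step
  have r1 : ((unip B (isSymm_single_same i c) * low C (isSymm_single_add_single i j) : Matrix.symplecticGroup l K) :
      Matrix (l ⊕ l) (l ⊕ l) K) = fromBlocks (1 + B * C) B C 1 := by
    rw [Submonoid.coe_mul, coe_unip, coe_low]
    simp only [fromBlocks_multiply, Matrix.one_mul, Matrix.mul_one, Matrix.mul_zero, zero_add]
  have r2 : ((unip B (isSymm_single_same i c) * low C (isSymm_single_add_single i j) *
      unip (-B) (isSymm_single_same i c).neg : Matrix.symplecticGroup l K) : Matrix (l ⊕ l) (l ⊕ l) K) =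
      fromBlocks (1 + B * C) 0 C (1 - C * B) := by
    rw [Submonoid.coe_mul, r1, coe_unip]
    simp only [fromBlocks_multiply, Matrix.one_mul, Matrix.mul_one, Matrix.mul_zero, add_zero, Matrix.mul_neg,
      Matrix.add_mul, hBCB, sub_eq_add_neg]
    rw [neg_add_cancel, add_comm (-(C * B)) 1]
  have r3 : ((unip B (isSymm_single_same i c) * low C (isSymm_single_add_single i j) *
      unip (-B) (isSymm_single_same i c).neg * low (-C) (isSymm_single_add_single i j).neg :
        Matrix.symplecticGroup l K) : Matrix (l ⊕ l) (l ⊕ l) K) =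
      fromBlocks (1 + Matrix.single i j c) 0 (Matrix.single j j c) (1 - Matrix.single j i c) := by
    rw [Submonoid.coe_mul, r2, coe_low]
    simp only [fromBlocks_multiply, Matrix.one_mul, Matrix.mul_one, Matrix.zero_mul, Matrix.mul_zero, zero_add,
      add_zero, Matrix.mul_neg, Matrix.sub_mul]
    rw [hCBC, hBC, hCB]
    congr 1 <;> abel
  exact Subtype.ext (lhs.trans r3.symm)

/-- A subgroup containing every `n(b)` and every `v(c)` contains the Levi transvections `m(1 + c E_{ij})`,
`i ≠ j`. [cite: Artin1988, Chap. V Thm 5.1 (proof)] -/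
theorem levi_transvection_mem_of_unip_low_mem {H : Subgroup (Matrix.symplecticGroup l K)}
    (hn : ∀ (b : Matrix l l K) (hb : b.IsSymm), unip b hb ∈ H)
    (hv : ∀ (c : Matrix l l K) (hc : c.IsSymm), low c hc ∈ H) (hij : i ≠ j) (c : K) (u : GL l K)
    (hu : (u : Matrix l l K) = transvection i j c) : levi u ∈ H := by
  rw [eq_inv_mul_of_mul_eq (low_mul_levi_transvection hij c u hu)]
  exact H.mul_mem (H.inv_mem (hv _ _)) (H.mul_mem (H.mul_mem (H.mul_mem (hn _ _) (hv _ _)) (hn _ _)) (hv _ _))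

end Transvection

/-! ## §3. Generation by `n(b)` and `v(c)` -/

/-- A subgroup containing every `n(b)` and every `v(c)` contains the whole Levi factor `m(GL_l(K))`: invertible
diagonal matrices are symmetric, transvections by §2, and `GL_l(K)` is generated by these
(`Matrix.diagonal_transvection_induction_of_det_ne_zero`). [cite: Artin1988, Chap. V Thm 5.1 (proof)] -/
theorem levi_mem_of_unip_low_mem {H : Subgroup (Matrix.symplecticGroup l K)}
    (hn : ∀ (b : Matrix l l K) (hb : b.IsSymm), unip b hb ∈ H)
    (hv : ∀ (c : Matrix l l K) (hc : c.IsSymm), low c hc ∈ H) (a : GL l K) : levi a ∈ H := by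
  suffices h : ∀ M : Matrix l l K, M.det ≠ 0 → ∀ u : GL l K, (u : Matrix l l K) = M → levi u ∈ H by
    refine h a ?_ a rfl
    exact (Matrix.isUnit_iff_isUnit_det _ |>.1 a.isUnit).ne_zero
  intro M hM
  refine Matrix.diagonal_transvection_induction_of_det_ne_zero
    (fun N => ∀ u : GL l K, (u : Matrix l l K) = N → levi u ∈ H) M hM ?_ ?_ ?_
  · intro D _ u hu
    exact levi_mem_of_isSymm_of_unip_low_mem hn hv u (by rw [hu]; exact isSymm_diagonal D)
  · rintro ⟨i, j, hij, c⟩ u hu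
    rw [TransvectionStruct.toMatrix_mk] at hu
    exact levi_transvection_mem_of_unip_low_mem hn hv hij c u hu
  · intro P Q hP hQ hPu hQu u hu
    have hu' : u = Matrix.GeneralLinearGroup.mkOfDetNeZero P hP * Matrix.GeneralLinearGroup.mkOfDetNeZero Q hQ := by
      apply Units.ext
      rw [Units.val_mul, hu]
      rfl
    rw [hu', levi_mul]
    exact H.mul_mem (hPu _ rfl) (hQu _ rfl)

/-- **`Sp_{2l}(K) = ⟨n(Sym_l(K)), v(Sym_l(K))⟩` for a field `K`**: a subgroup of the symplectic group containing
the unipotent radicals of the two opposite Siegel parabolics is everything.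
[cite: Artin1988, Chap. V Thm 5.1 (proof: `Sp_n(k)` is generated by symplectic transvections)] -/
theorem eq_top_of_unip_low_mem {H : Subgroup (Matrix.symplecticGroup l K)}
    (hn : ∀ (b : Matrix l l K) (hb : b.IsSymm), unip b hb ∈ H)
    (hv : ∀ (c : Matrix l l K) (hc : c.IsSymm), low c hc ∈ H) : H = ⊤ :=
  eq_top_of_generators_mem (levi_mem_of_unip_low_mem hn hv) hn (symJ_mem_of_unip_low_mem hn hv)

/-- `Sp_{2l}(K)` is the subgroup generated by the `n(b)` and `v(c)`, `b`, `c` symmetric.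
[cite: Artin1988, Chap. V Thm 5.1 (proof)] -/
theorem closure_unip_low_eq_top :
    Subgroup.closure ({g : Matrix.symplecticGroup l K | ∃ (b : Matrix l l K) (hb : b.IsSymm), unip b hb = g} ∪
      {g | ∃ (c : Matrix l l K) (hc : c.IsSymm), low c hc = g}) = ⊤ :=
  eq_top_of_unip_low_mem (fun b hb ↦ Subgroup.subset_closure (Or.inl ⟨b, hb, rfl⟩))
    (fun c hc ↦ Subgroup.subset_closure (Or.inr ⟨c, hc, rfl⟩))

/-- Every `g ∈ Sp_{2l}(K)` is a product of `n(b)`'s, `v(c)`'s and their inverses.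
[cite: Artin1988, Chap. V Thm 5.1 (proof)] -/
theorem mem_closure_unip_low (g : Matrix.symplecticGroup l K) :
    g ∈ Subgroup.closure ({g : Matrix.symplecticGroup l K | ∃ (b : Matrix l l K) (hb : b.IsSymm), unip b hb = g} ∪
      {g | ∃ (c : Matrix l l K) (hc : c.IsSymm), low c hc = g}) := by
  rw [closure_unip_low_eq_top]; exact Subgroup.mem_top g

end Literature.LinearAlgebra.Matrix.SymplecticMatrix
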